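import Literature.NumberTheory.Rogawski1990.FinExplicitTransferFactorSplitPlaceTau  -- ★ `isUnit_det_fst_map_apply`; transitively `charpoly_map_galInv_eq_charpoly_inv`, `eval_charpoly_inv_two`, `galAdicCompletionMap_finGammaTwo_galInv`
import Literature.NumberTheory.Rogawski1990.LocalNormFibreNonsplit                -- ★ `charpoly_endoEmbLocal`
import Literature.NumberTheory.Automorphic.UnitaryGroupConstantTermSplit          -- ★ `cmSplitEquivTwo`, `cmSplitEquivOne`
import Literature.Algebra.Polynomial.SeparablePi                                  -- ★ `separable_iff_forall_map_evalRingHom`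
import HarnessLib

/-!
# `G`-regularity of `γ_H ∈ H_v = U(Φ₂) × U(Φ₁)` at a place split in `L`, read at ONE place `w ∣ v`:
# `disc(g_w) ≠ 0 ∧ χ_{g_w}(u_w) ≠ 0 ⇒ γ_H = (g, u)` is `G`-regular (Rogawski 1990, §4.3 p. 42, §4.9 pp. 54–55)

Cell `pub/hodgecm-mathlib`, squad K2, seat K2E4-p02 (g0); `--supports stmt-HodgeConjecture-24833 --as helper`.  THEOREMS ONLY (no definition,
no named fact, no instance, no `sorry`).  First brick of the reduction `T0` of the split-place central transfer vanishing (socket U3b-a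
`sig_K2E3CentralTransferVanishing` restricted to `¬ Subsingleton (PlacesOver L v)`) to a frame-free density statement on `GL₂(L_w) × GL₁(L_w)`
(K2E4-p01 (g2)'s core `K2E3GLTwoCentralDensityRamifiedTorus`): the core's hypothesis quantifies over pairs `(h, u) ∈ GL₂(L_w) × GL₁(L_w)` with
`(tr h)² − 4 det h ≠ 0` and `χ_h(u) ≠ 0`; this file shows that these two `w`-side conditions make `j_w⁻¹(h, u) ∈ H_v` `G`-REGULAR, so that the
central transfer vanishing hypothesis (stated for `G`-regular classes only) applies to it.

THE MATHEMATICS.  `ι_v(γ_H) = diag-block(g, u) ∈ GL₃(E_v)`, `E_v = ∏_{w′∣v} L_{w′}`, has characteristic polynomial `χ_g · (X − u)` (★ `charpoly_endoEmbLocal`);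
`G`-regular means this is separable over `E_v`, i.e. (★ `separable_iff_forall_map_evalRingHom`) separable at every `w′ ∣ v`, and `w′ ∈ {w, w̄}`
(★ `PlacesOver.eq_or_eq_galInv`).  At `w`: a product `f · (X − u)` with `f = X² − tX + d` is separable as soon as `t² − 4d` and `f(u)` are units
(explicit Bézout: `δ = f′² − 4f`, `f ≡ f(u) mod (X − u)`).  At `w̄`: transport along the field embedding `σ : L_{w̄} → L_w` (separability is invariant,
`Polynomial.separable_map`); unitarity gives `charpoly σ(g_{w̄}) = charpoly g_w⁻¹` (★ `charpoly_map_galInv_eq_charpoly_inv`) and `σ(u_{w̄}) = u_w⁻¹`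
(★ `galAdicCompletionMap_finGammaTwo_galInv`), and for `2 × 2` matrices `disc(M⁻¹) = disc(M)·(det M)⁻²`, `χ_{M⁻¹}(t⁻¹) = χ_M(t)·(det M)⁻¹·t⁻²`
(★ `eval_charpoly_inv_two`), so the `w̄`-conditions follow from the `w`-conditions.

* §1 `separable_X_sq_of_isUnit_discr`, `isCoprime_X_sub_C_of_isUnit_eval`, `separable_charpoly_two_mul_X_sub_C` (commutative-ring algebra).
* §2 `discr_inv_two` (`2 × 2` over a field).
* §3 **`isLocalGRegular_of_discr_ne_zero_of_eval_ne_zero`** (components `g.map (· w)`, `u_w = finGammaTwo … w`) and its `cmSplitEquivTwo ∕ cmSplitEquivOne`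
  spelling **`isLocalGRegular_of_cmSplitEquiv`**.

HONEST LABEL: HC_CM is proved only modulo the 7 printed citations (2 remaining named inputs: hLiu418 = stmt-HodgeConjecture-24832, h413 =
stmt-HodgeConjecture-24833) until rung 0 closes; this file pays none of them.

## References
* [Rogawski1990] J. D. Rogawski, *Automorphic Representations of Unitary Groups in Three Variables*, Ann. of Math. Stud. 123 (1990), §4.3 p. 42
  (`G`-regular elements of `H`), §4.9 pp. 54–55 (split places: `H_v ≅ GL₂ × GL₁`, `χ_g(u)`).
* [Lang2002] S. Lang, *Algebra*, 3rd ed., GTM 211 (2002), Ch. II §5 (polynomials over products), Ch. V §4 (separable polynomials).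
-/

set_option autoImplicit false

set_option linter.dupNamespace false

noncomputable section

open NumberField IsDedekindDomain Matrix Polynomial
open scoped MatrixGroups

namespace Summit.HodgeConjecture.HodgeConjecture.Cruxes.H413.K2E3CentralTransferVanishingSplit

open Literature.NumberTheory.Rogawski1990 Literature.NumberTheory.Automorphic Literature.NumberTheory.GaloisRepresentations

/-! ## §1 Separability of `(X² − tX + d)·(X − u)` from two unit conditions -/

section Algebra

variable {R : Type*} [CommRing R]

/-- `X² − tX + d` is separable over a commutative ring as soon as its discriminant `t² − 4d` is a unit: with `f′ = 2X − t` one has `f′² − 4f = t² − 4d`,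
an explicit Bézout relation. [cite: Lang2002, Ch. V §4] -/
theorem separable_X_sq_of_isUnit_discr (t d : R) (h : IsUnit (t ^ 2 - 4 * d)) : (X ^ 2 - C t * X + C d : R[X]).Separable := by
  obtain ⟨e, he⟩ := h.exists_left_inv
  have hd : derivative (X ^ 2 - C t * X + C d : R[X]) = C (2 : R) * X - C t := by
    simp only [derivative_add, derivative_sub, derivative_X_pow, derivative_mul, derivative_C, derivative_X, zero_mul, mul_one, zero_add, add_zero,
      Nat.cast_ofNat, map_ofNat]
    ring
  rw [Polynomial.separable_def, hd]
  refine ⟨C (-(4 * e)), C e * (C (2 : R) * X - C t), ?_⟩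
  have key : C (-(4 * e)) * (X ^ 2 - C t * X + C d) + C e * (C (2 : R) * X - C t) * (C (2 : R) * X - C t) = (C (e * (t ^ 2 - 4 * d)) : R[X]) := by
    simp only [map_mul, map_sub, map_neg, map_pow, map_ofNat]
    ring
  rw [key, he, map_one]

/-- `f` is coprime to `X − u` as soon as `f(u)` is a unit (`f ≡ f(u) mod (X − u)`). [cite: Lang2002, Ch. IV §1] -/
theorem isCoprime_X_sub_C_of_isUnit_eval (f : R[X]) (u : R) (h : IsUnit (f.eval u)) : IsCoprime f (X - C u) := by
  obtain ⟨e, he⟩ := h.exists_left_inv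
  set q := f /ₘ (X - C u) with hq
  have hdiv : C (f.eval u) + (X - C u) * q = f := by
    rw [hq, ← modByMonic_X_sub_C_eq_C_eval]
    exact modByMonic_add_div f (X - C u)
  have he' : C e * C (f.eval u) = (1 : R[X]) := by rw [← map_mul, he, map_one]
  exact ⟨C e, -(C e * q), by linear_combination (-(C e)) * hdiv + he'⟩

/-- For a `2 × 2` matrix `M` and a scalar `u`: if `(tr M)² − 4 det M` and `χ_M(u)` are units then `χ_M · (X − u)` is separable. [cite: Lang2002, Ch. V §4] -/
theorem separable_charpoly_two_mul_X_sub_C [Nontrivial R] (M : Matrix (Fin 2) (Fin 2) R) (u : R) (hdisc : IsUnit (M.trace ^ 2 - 4 * M.det))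
    (heval : IsUnit (M.charpoly.eval u)) : (M.charpoly * (X - C u)).Separable := by
  refine Polynomial.Separable.mul ?_ (separable_X_sub_C (x := u)) (isCoprime_X_sub_C_of_isUnit_eval _ _ heval)
  rw [Matrix.charpoly_fin_two]
  exact separable_X_sq_of_isUnit_discr _ _ hdisc

end Algebra

/-! ## §2 `disc(M⁻¹) = disc(M) · (det M)⁻²` for `2 × 2` matrices over a field -/

section TwoByTwo

variable {K : Type*} [Field K]

/-- `(tr M⁻¹)² − 4 det M⁻¹ = ((tr M)² − 4 det M) · (det M)⁻²` for an invertible `2 × 2` matrix (`M⁻¹ = (det M)⁻¹ adj M`, `tr adj M = tr M`, `det adj M = det M`).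
[cite: Lang2002, Ch. XIII §4] -/
theorem discr_inv_two (M : Matrix (Fin 2) (Fin 2) K) (hM : IsUnit M.det) :
    (M⁻¹).trace ^ 2 - 4 * (M⁻¹).det = (M.trace ^ 2 - 4 * M.det) * (M.det ^ 2)⁻¹ := by
  have hdet : M.det ≠ 0 := hM.ne_zero
  have hinv : M⁻¹ = (M.det)⁻¹ • M.adjugate := by
    rw [Matrix.inv_def, Ring.inverse_eq_inv']
  rw [hinv, Matrix.adjugate_fin_two]
  simp only [Matrix.trace_fin_two, Matrix.det_fin_two, Matrix.smul_apply, Matrix.of_apply, Matrix.cons_val', Matrix.cons_val_zero, Matrix.cons_val_one,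
    Matrix.empty_val', Matrix.cons_val_fin_one, smul_eq_mul]
  rw [Matrix.det_fin_two] at hdet
  field_simp
  ring

end TwoByTwo

/-! ## §3 The criterion on `H_v` -/

section Split

variable (L : Type) [Field L] [NumberField L] [IsCMField L] (v : HeightOneSpectrum (𝓞 ↥(maximalRealSubfield L)))
  (a : (UnitaryGroup.cmDatum L 2 (Matrix.of fun i j : Fin 2 => if i.val + j.val + 1 = 2 then (1 : L) else 0)).Local v ×
      (UnitaryGroup.cmDatum L 1 (Matrix.of fun i j : Fin 1 => if i.val + j.val + 1 = 1 then (1 : L) else 0)).Local v)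
  (w : UnitaryGroup.PlacesOver L v)

/-- The `w′`-component of `charpoly ι_v(γ_H) = χ_g · (X − u)`: `χ_{g_{w′}} · (X − u_{w′})`. [cite: Rogawski1990, §4.3 p. 42] -/
theorem map_evalRingHom_charpoly_endoEmbLocal (w' : UnitaryGroup.PlacesOver L v) :
    (((endoEmbLocal L v a).val.val : Matrix (Fin 3) (Fin 3) (UnitaryGroup.LocalRing L v)).charpoly).map
        (Pi.evalRingHom (fun w : UnitaryGroup.PlacesOver L v => w.1.adicCompletion L) w') =
      ((a.1.val.val : Matrix (Fin 2) (Fin 2) (UnitaryGroup.LocalRing L v)).map (fun x => x w')).charpoly * (X - C (finGammaTwo L v a w')) := by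
  rw [charpoly_endoEmbLocal, Polynomial.map_mul, Polynomial.map_sub, Polynomial.map_X, Polynomial.map_C]
  unfold finCharpolyTwo
  rw [← Matrix.charpoly_map]
  rfl

/-- **`G`-REGULARITY READ AT ONE PLACE.**  For `γ_H = (g, u) ∈ H_v` and a place `w ∣ v`: if the `w`-components `g_w`, `u_w` satisfy
`(tr g_w)² − 4 det g_w ≠ 0` and `χ_{g_w}(u_w) ≠ 0`, then `γ_H` is `G`-regular (`ι_v(γ_H)` regular semisimple in `GL₃(∏_{w′∣v} L_{w′})`); the conditions
at the conjugate place `w̄` follow by unitarity (`charpoly σ(g_{w̄}) = charpoly g_w⁻¹`, `σ(u_{w̄}) = u_w⁻¹`). [cite: Rogawski1990, §4.3 p. 42; §4.9 pp. 54–55] -/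
theorem isLocalGRegular_of_discr_ne_zero_of_eval_ne_zero
    (hdisc : ((a.1.val.val : Matrix (Fin 2) (Fin 2) (UnitaryGroup.LocalRing L v)).map (fun x => x w)).trace ^ 2 -
        4 * ((a.1.val.val : Matrix (Fin 2) (Fin 2) (UnitaryGroup.LocalRing L v)).map (fun x => x w)).det ≠ 0)
    (heval : (((a.1.val.val : Matrix (Fin 2) (Fin 2) (UnitaryGroup.LocalRing L v)).map (fun x => x w)).charpoly).eval (finGammaTwo L v a w) ≠ 0) :
    IsLocalGRegular L v a := by
  classical
  haveI : Algebra.IsQuadraticExtension ↥(maximalRealSubfield L) L := IsCMField.isQuadraticExtension L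
  change IsRegularElt ((endoEmbLocal L v a).val : GL (Fin 3) (UnitaryGroup.LocalRing L v))
  rw [isRegularElt_iff, Literature.Algebra.Polynomial.separable_iff_forall_map_evalRingHom]
  intro w'
  rw [map_evalRingHom_charpoly_endoEmbLocal]
  rcases UnitaryGroup.PlacesOver.eq_or_eq_galInv (IsCMField.complexConj L) (IsCMField.complexConj_ne_one L) w w' with rfl | rfl
  · exact separable_charpoly_two_mul_X_sub_C _ _ (isUnit_iff_ne_zero.2 hdisc) (isUnit_iff_ne_zero.2 heval)
  · set σ := galAdicCompletionMap (L := L) (IsCMField.complexConj L) (smul_inv_smul (IsCMField.complexConj L) w.1) with hσ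
    rw [← Polynomial.separable_map σ, Polynomial.map_mul, Polynomial.map_sub, Polynomial.map_X, Polynomial.map_C, ← Matrix.charpoly_map]
    have hgw : IsUnit ((a.1.val.val : Matrix (Fin 2) (Fin 2) (UnitaryGroup.LocalRing L v)).map (fun x => x w)).det :=
      isUnit_det_fst_map_apply L v a w
    have hu : finGammaTwo L v a w ≠ 0 := ((Pi.isUnit_iff.1 (isUnit_finGammaTwo L v a)) w).ne_zero
    have hcp := charpoly_map_galInv_eq_charpoly_inv L v a w
    have hσu := galAdicCompletionMap_finGammaTwo_galInv L v a w
    change (((a.1.val.val : Matrix (Fin 2) (Fin 2) (UnitaryGroup.LocalRing L v)).map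
        (fun x => x (UnitaryGroup.PlacesOver.galInv (IsCMField.complexConj L) w))).map σ).charpoly *
        (X - C (σ (finGammaTwo L v a (UnitaryGroup.PlacesOver.galInv (IsCMField.complexConj L) w))))
      |>.Separable
    rw [hcp, hσu]
    refine separable_charpoly_two_mul_X_sub_C _ _ (isUnit_iff_ne_zero.2 ?_) (isUnit_iff_ne_zero.2 ?_)
    · rw [discr_inv_two _ hgw]
      exact mul_ne_zero hdisc (inv_ne_zero (pow_ne_zero 2 hgw.ne_zero))
    · rw [eval_charpoly_inv_two _ hgw hu]
      exact mul_ne_zero (mul_ne_zero heval (inv_ne_zero hgw.ne_zero)) (inv_ne_zero (pow_ne_zero 2 hu))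

/-- **The same criterion in the `cmSplitEquiv` coordinates** `h = j_w(g) ∈ GL₂(L_w)`, `u_w = j_w(u) ∈ GL₁(L_w)` (★ `cmSplitEquivTwo`, `cmSplitEquivOne`;
definitionally the `w`-projections). [cite: Rogawski1990, §4.3 p. 42; §4.9 pp. 54–55] -/
theorem isLocalGRegular_of_cmSplitEquiv (hw : IsCMField.complexConj L • w.1 ≠ w.1)
    (hdisc : ((UnitaryGroup.cmSplitEquivTwo L v w hw a.1 : GL (Fin 2) (w.1.adicCompletion L)) : Matrix (Fin 2) (Fin 2) (w.1.adicCompletion L)).trace ^ 2 -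
        4 * ((UnitaryGroup.cmSplitEquivTwo L v w hw a.1 : GL (Fin 2) (w.1.adicCompletion L)) : Matrix (Fin 2) (Fin 2) (w.1.adicCompletion L)).det ≠ 0)
    (heval : (((UnitaryGroup.cmSplitEquivTwo L v w hw a.1 : GL (Fin 2) (w.1.adicCompletion L)) : Matrix (Fin 2) (Fin 2) (w.1.adicCompletion L)).charpoly).eval
        (((UnitaryGroup.cmSplitEquivOne L v w hw a.2 : GL (Fin 1) (w.1.adicCompletion L)) : Matrix (Fin 1) (Fin 1) (w.1.adicCompletion L)) 0 0) ≠ 0) :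
    IsLocalGRegular L v a :=
  isLocalGRegular_of_discr_ne_zero_of_eval_ne_zero L v a w hdisc heval

end Split

end Summit.HodgeConjecture.HodgeConjecture.Cruxes.H413.K2E3CentralTransferVanishingSplit

end
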